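import Summits.ResolutionOfSingularities.ResolutionOfSingularities.Theorems.WeightedInvariantWeightedConstructionPlexComapCotangent
import Literature.AlgebraicGeometry.Resolution.DerivativeIdealsSupport
import Mathlib.AlgebraicGeometry.Morphisms.Smooth
import HarnessLib

/-!
# B2′ ⊇ at the stalks: cotangent classes ascend along the stalk map of a smooth morphism

Route `ResolutionOfSingularities/WeightedInvariant`, crux `WeightedConstruction`
(stmt-ResolutionOfSingularities-0571), line `pointwise-lexmax-hull`, stub `stub_plexComap` (B2′), ⊇-half.
[OURS · L1 W4.3] Scheme-level form of `linearIndependent_toCotangent_map_of_formallySmooth`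
(`…PlexComapCotangent.lean`): for `f : Y → Spec k` smooth and `g : Y₁ → Y` smooth, at any point `y₁`
whose image has residue field formally smooth over `k` (e.g. a closed point, `k` perfect), elements of
`𝔪_{Y, g y₁}` that are part of a regular system of parameters stay so in `𝒪_{Y₁, y₁}` after `g^*`.
The `k`-structure on the stalk is the tree's `stalkAlgebra` of `DerivativeIdealSheaf.lean`; formal
smoothness of the stalk is `formallySmooth_stalk_overHom`, of the stalk map `Scheme.Hom.mem_smoothLocus`.
No new mathematics; NOT a statement of the manuscript under review.
-/

noncomputable section

set_option linter.dupNamespace false -- mandated namespace of this single-conjunct summit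

open CategoryTheory CategoryTheory.Limits AlgebraicGeometry TopologicalSpace IsLocalRing
open Literature.AlgebraicGeometry.Resolution

namespace Summit.ResolutionOfSingularities.ResolutionOfSingularities.Theorems

/-- **Part of a regular system of parameters ascends along a smooth morphism (stalk form).** Let
`f : Y → Spec k` and `g : Y₁ → Y` be smooth, `y₁ ∈ Y₁`, and assume the residue field `κ(g y₁)` is formally
smooth over `k` (for the `k`-structure `k → Γ(Y, 𝒪_Y) → 𝒪_{Y, g y₁}`). If `v₁, …, v_m ∈ 𝔪_{Y, g y₁}` have
`κ(g y₁)`-linearly independent classes in `𝔪/𝔪²`, then the `g^* vᵢ ∈ 𝔪_{Y₁, y₁}` have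
`κ(y₁)`-linearly independent classes in `𝔪/𝔪²`. [folklore] -/
theorem linearIndependent_toCotangent_stalkMap_of_smooth ⦃k : Type⦄ [Field k]
    ⦃Y Y₁ : Scheme.{0}⦄ (f : Y ⟶ Spec (.of k)) [Smooth f] (g : Y₁ ⟶ Y) [Smooth g] (y₁ : Y₁)
    (hκ : letI := stalkAlgebra (f.appTop.hom.comp (Scheme.ΓSpecIso (.of k)).inv.hom) (g y₁)
      Algebra.FormallySmooth k (ResidueField (Y.presheaf.stalk (g y₁))))
    {ι : Type*} (v : ι → Y.presheaf.stalk (g y₁))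
    (hv : ∀ i, v i ∈ maximalIdeal (Y.presheaf.stalk (g y₁)))
    (hli : LinearIndependent (ResidueField (Y.presheaf.stalk (g y₁)))
      fun i => (maximalIdeal (Y.presheaf.stalk (g y₁))).toCotangent ⟨v i, hv i⟩) :
    LinearIndependent (ResidueField (Y₁.presheaf.stalk y₁)) fun i =>
      (maximalIdeal (Y₁.presheaf.stalk y₁)).toCotangent
        ⟨(g.stalkMap y₁).hom (v i), map_nonunit (g.stalkMap y₁).hom (v i) (hv i)⟩ := by
  letI : Y.Over (Spec (.of k)) := ⟨f⟩
  haveI : Smooth (Y ↘ Spec (.of k)) := ‹Smooth f›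
  letI algP : Algebra k (Y.presheaf.stalk (g y₁)) := stalkAlgebra (overHom k Y) (g y₁)
  letI algPS : Algebra (Y.presheaf.stalk (g y₁)) (Y₁.presheaf.stalk y₁) :=
    (g.stalkMap y₁).hom.toAlgebra
  letI algS : Algebra k (Y₁.presheaf.stalk y₁) :=
    ((g.stalkMap y₁).hom.comp (stalkHom (overHom k Y) (g y₁))).toAlgebra
  haveI : IsScalarTower k (Y.presheaf.stalk (g y₁)) (Y₁.presheaf.stalk y₁) :=
    IsScalarTower.of_algebraMap_eq fun _ => rfl
  haveI : Algebra.FormallySmooth k (Y.presheaf.stalk (g y₁)) := formallySmooth_stalk_overHom k Y (g y₁)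
  haveI : Algebra.FormallySmooth (Y.presheaf.stalk (g y₁)) (Y₁.presheaf.stalk y₁) := by
    have hmem : y₁ ∈ g.smoothLocus := by rw [Scheme.Hom.smoothLocus_eq_top]; trivial
    exact Scheme.Hom.mem_smoothLocus.mp hmem
  haveI : IsLocalHom (algebraMap (Y.presheaf.stalk (g y₁)) (Y₁.presheaf.stalk y₁)) :=
    inferInstanceAs (IsLocalHom (g.stalkMap y₁).hom)
  haveI : Algebra.FormallySmooth k (ResidueField (Y.presheaf.stalk (g y₁))) := hκ
  exact linearIndependent_toCotangent_map_of_formallySmooth (k := k) v hv hli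

end Summit.ResolutionOfSingularities.ResolutionOfSingularities.Theorems

end
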